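import Mathlib

/-!
# Crux `GappedShellCensus.ShellTrichotomy` (stmt-AtomisticToContinuum-18070), line `Sketch` —
# stub `stub_kill4T`

**The `4T` kill.**  In the finite abstraction of the fan triangulation of a gapped 12-point
shell (`bond` the bond graph on the labels `Fin 12`, `tri` the fan triangles as label sets,
`ang S v` the fan angle of the triangle `S` at the label `v`), no label `v` can have a fan star
consisting of four bond triangles `{v,a,b}, {v,b,c}, {v,c,d}, {v,d,a}`.

## Proof

The fan angles at `v` sum to `2π` over `tri`; the terms with `v ∉ S` vanish, so the sum is the
sum over the star `tri.filter (v ∈ ·) = {{v,a,b}, {v,b,c}, {v,c,d}, {v,d,a}}`.  By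
nonnegativity this is at most the sum of the four corner angles (the four sets need not be
distinct), each triangle lies in `tri` and has all pairs bonded, so each corner angle is at most
`arccos (1/4) < π/2`.  Hence `2π < 2π`.
-/

namespace Summit.AtomisticToContinuum.Crystallization.Theorems

/-- For a nonnegative real function, the sum over the literal `{a, b, c, d}` (whose entries need
not be distinct) is at most `f a + f b + f c + f d`. -/
private theorem sum_four_le {ι : Type*} [DecidableEq ι] (f : ι → ℝ) (hf : ∀ x, 0 ≤ f x)
    (a b c d : ι) :
    ∑ x ∈ ({a, b, c, d} : Finset ι), f x ≤ f a + f b + f c + f d := by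
  have key : ∀ (e : ι) (s : Finset ι), ∑ x ∈ insert e s, f x ≤ f e + ∑ x ∈ s, f x := by
    intro e s
    by_cases h : e ∈ s
    · rw [Finset.insert_eq_of_mem h]
      linarith [hf e]
    · rw [Finset.sum_insert h]
  have h1 := key a {b, c, d}
  have h2 := key b {c, d}
  have h3 := key c {d}
  rw [Finset.sum_singleton] at h3
  linarith

/-- If `bond` is symmetric and the three pairs `xy`, `yz`, `xz` are bonded, then every pair of
distinct elements of the label set `{x, y, z}` is bonded. -/
private theorem bond_pairs_of_three (bond : Fin 12 → Fin 12 → Bool)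
    (bond_symm : ∀ v w, bond v w = bond w v) (x y z : Fin 12)
    (hxy : bond x y = true) (hyz : bond y z = true) (hxz : bond x z = true) :
    ∀ p ∈ ({x, y, z} : Finset (Fin 12)), ∀ q ∈ ({x, y, z} : Finset (Fin 12)),
      p ≠ q → bond p q = true := by
  intro p hp q hq hpq
  simp only [Finset.mem_insert, Finset.mem_singleton] at hp hq
  rcases hp with rfl | rfl | rfl <;> rcases hq with rfl | rfl | rfl
  all_goals first
    | exact absurd rfl hpq
    | assumption
    | (rw [bond_symm]; assumption)

/-- **The `4T` kill** (crux `GappedShellCensus.ShellTrichotomy`, line `Sketch`): a label `v`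
whose fan star consists of the four bond triangles `{v,a,b}, {v,b,c}, {v,c,d}, {v,d,a}` is
impossible, since the four corner angles at `v` are each at most `arccos (1/4) < π/2` but must
sum to `2π`. -/
theorem stub_kill4T (bond : Fin 12 → Fin 12 → Bool) (tri : Finset (Finset (Fin 12)))
    (ang : Finset (Fin 12) → Fin 12 → ℝ) (bond_symm : ∀ v w, bond v w = bond w v)
    (ang_nonneg : ∀ S v, 0 ≤ ang S v) (ang_zero : ∀ S v, v ∉ S → ang S v = 0)
    (sum_ang : ∀ v, ∑ S ∈ tri, ang S v = 2 * Real.pi)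
    (tCorner : ∀ S ∈ tri, (∀ v ∈ S, ∀ w ∈ S, v ≠ w → bond v w = true) → ∀ v ∈ S, ang S v ≤ Real.arccos (1 / 4))
    (v a b c d : Fin 12)
    (hstar : (tri.filter fun S => v ∈ S) = {{v, a, b}, {v, b, c}, {v, c, d}, {v, d, a}})
    (hva : bond v a = true) (hvb : bond v b = true) (hvc : bond v c = true) (hvd : bond v d = true)
    (hab : bond a b = true) (hbc : bond b c = true) (hcd : bond c d = true) (hda : bond d a = true) :
    False := by
  -- The angle sum at `v` localises to the star of `v`.
  have hsum : ∑ S ∈ tri.filter (fun S => v ∈ S), ang S v = 2 * Real.pi := by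
    rw [Finset.sum_filter_of_ne, sum_ang v]
    intro S _ hne
    by_contra h
    exact hne (ang_zero S v h)
  rw [hstar] at hsum
  -- The sum over the (possibly repetitive) star literal is at most the sum of the four corners.
  have hle : ∑ S ∈ ({{v, a, b}, {v, b, c}, {v, c, d}, {v, d, a}} : Finset (Finset (Fin 12))),
      ang S v ≤ ang {v, a, b} v + ang {v, b, c} v + ang {v, c, d} v + ang {v, d, a} v :=
    sum_four_le (fun S => ang S v) (fun S => ang_nonneg S v) _ _ _ _
  -- Each star triangle lies in `tri` and contains `v`.
  have memtri : ∀ S ∈ ({{v, a, b}, {v, b, c}, {v, c, d}, {v, d, a}} : Finset (Finset (Fin 12))),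
      S ∈ tri ∧ v ∈ S := by
    intro S hS
    rw [← hstar] at hS
    exact Finset.mem_filter.mp hS
  -- Each star triangle is a bond triangle, so its corner at `v` is at most `arccos (1/4)`.
  have h1 : ang {v, a, b} v ≤ Real.arccos (1 / 4) := by
    have hm := memtri {v, a, b} (by simp)
    exact tCorner _ hm.1 (bond_pairs_of_three bond bond_symm v a b hva hab hvb) v hm.2
  have h2 : ang {v, b, c} v ≤ Real.arccos (1 / 4) := by
    have hm := memtri {v, b, c} (by simp)
    exact tCorner _ hm.1 (bond_pairs_of_three bond bond_symm v b c hvb hbc hvc) v hm.2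
  have h3 : ang {v, c, d} v ≤ Real.arccos (1 / 4) := by
    have hm := memtri {v, c, d} (by simp)
    exact tCorner _ hm.1 (bond_pairs_of_three bond bond_symm v c d hvc hcd hvd) v hm.2
  have h4 : ang {v, d, a} v ≤ Real.arccos (1 / 4) := by
    have hm := memtri {v, d, a} (by simp)
    exact tCorner _ hm.1 (bond_pairs_of_three bond bond_symm v d a hvd hda hva) v hm.2
  -- But `arccos (1/4) < π/2`, so the four corners cannot add up to `2π`.
  have harc : Real.arccos (1 / 4) < Real.pi / 2 := Real.arccos_lt_pi_div_two.2 (by norm_num)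
  linarith
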